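import Literature.Computability.Cryptography.LWEBinaryHybrids
import HarnessLib

/-!
# BLPRS 2013, Lemma 4.8 for the `z`-choosing `extLWE` game (`extLWE ≤ extLWE^t` with the adversary's `z ← ζ`)

Topic `Computability/Cryptography` (LWE), grouping namespace `LWE`; sequel of `ExtLWE.lean` (Def. 4.4,
Lemma 4.8 for a FIXED choice `z`: `extLWEAdvantage_multiReduction`, `t · Adv[ℬ] = Adv[𝒜]`) and of
`LWEBinaryHybrids.lean` (the game `extLWERealZ / extLWEIdealZ / extLWEAdvantageZ` in which the adversary
first draws `z ← ζ`, as in Def. 4.4 "the algorithm gets to choose `z ∈ 𝒵`", the form consumed by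
Lemma 4.9's adversary `ℬ₁`). Proved material (no named fact) towards
`Literature.Computability.Cryptography.blprs_gapSVP_sqrt_dim_to_lwe_classical` (pqc.S21):

> **Lemma 4.8.** … there is an efficient (transformation) reduction from `extLWE_{n,m,q,χ,𝒵}` to
> `extLWE^t_{n,m,q,χ,𝒵}` that reduces the advantage by a factor of `t`. … *Proof.* Let `𝒜` be an algorithm
> for `extLWE^t`, let `z` be the vector output by `𝒜` in the first step (note that this is a random
> variable) … First, `ℬ` runs `𝒜` to obtain `z` and sends it to the challenger as its own `z`. …

## Results (`k` = LWE dimension, `n` = hint dimension; `t ≥ 1` positions)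

* `toReal_acceptProb_extLWEMultiReduction_sub` — the SIGNED form of the fixed-`z` computation:
  `t · (Pr[ℬ_z | P₀] - Pr[ℬ_z | P₁]) = Pr[𝒜_z(H_t)] - Pr[𝒜_z(H_0)]`;
* `extLWEMultiReductionZ χ t D` — `ℬ` for an adversary `D` of the `z`-choosing `extLWE^t` game: with the
  drawn `z`, run `ℬ_z` for `𝒜_z = D(z, ·)`; `toReal_acceptProb_choice` (acceptance probability of a
  `z`-choosing game as the `ζ`-average of the fixed-`z` ones);
* **`extLWEAdvantageZ_multiReduction`** — `t · Adv^{ζ}[ℬ] = Adv^{ζ}[𝒜]` for every law `ζ` of `z`.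

## References

* Z. Brakerski, A. Langlois, C. Peikert, O. Regev, D. Stehlé, *Classical hardness of learning with errors*,
  STOC 2013; arXiv:1306.0281, Def. 4.4 and Lemma 4.8 with its proof (p. 15).
-/

noncomputable section

open scoped ENNReal
open Matrix Literature.Probability.Distributions

namespace Literature.Computability.Cryptography

namespace LWE

variable {R : Type} [CommRing R] [Fintype R] {k n : ℕ}

/-- **Lemma 4.8, signed form for a fixed `z`**: `t · (Pr[ℬ | first case] - Pr[ℬ | second case]) =
Pr[𝒜(extLWE^t, first)] - Pr[𝒜(extLWE^t, second)]` (the telescoping sum over the hybrids, before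
taking absolute values). [cite: BrakerskiEtAl2013, Lemma 4.8 (proof)] -/
theorem toReal_acceptProb_extLWEMultiReduction_sub (χ : PMF (Fin n → ℤ)) (t : ℕ) [NeZero t] (z : Fin n → ℤ)
    (D : Matrix (Fin k) (Fin n) R × (Fin t → (Fin n → R) × ℤ) → PMF Bool) :
    (t : ℝ) * ((acceptProb (extLWEMultiReduction χ t z D) (extLWEReal χ 1 z)).toReal -
        (acceptProb (extLWEMultiReduction χ t z D) (extLWEIdeal k χ 1 z)).toReal) =
      (acceptProb D (extLWEReal χ t z)).toReal - (acceptProb D (extLWEIdeal k χ t z)).toReal := by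
  set h : ℕ → ℝ := fun j => (acceptProb D (extLWEHybrid (n := k) (R := R) χ t z j)).toReal with hh
  have ht : (0 : ℝ) < t := by exact_mod_cast Nat.pos_of_ne_zero (NeZero.ne t)
  have hreal : (acceptProb (extLWEMultiReduction χ t z D) (extLWEReal χ 1 z)).toReal =
      ∑ iStar : Fin t, (t : ℝ)⁻¹ * h (iStar + 1) := by
    rw [acceptProb_extLWEMultiReduction, toReal_acceptProb_uniform_bind]
    refine Finset.sum_congr rfl fun iStar _ => ?_
    rw [Fintype.card_fin, extLWEReal_one_bind_fill]
  have hideal : (acceptProb (extLWEMultiReduction χ t z D) (extLWEIdeal k χ 1 z)).toReal =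
      ∑ iStar : Fin t, (t : ℝ)⁻¹ * h iStar := by
    rw [acceptProb_extLWEMultiReduction, toReal_acceptProb_uniform_bind]
    refine Finset.sum_congr rfl fun iStar _ => ?_
    rw [Fintype.card_fin, extLWEIdeal_one_bind_fill]
  rw [hreal, hideal, ← Finset.sum_sub_distrib]
  simp_rw [← mul_sub]
  rw [← Finset.mul_sum, ← mul_assoc, mul_inv_cancel₀ ht.ne', one_mul,
    Fin.sum_univ_eq_sum_range (fun i => h (i + 1) - h i) t, Finset.sum_range_sub, extLWEReal_eq_hybrid,
    extLWEIdeal_eq_hybrid]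

/-- **`ℬ` in the `z`-choosing game**: "`ℬ` runs `𝒜` to obtain `z` and sends it to the challenger as its own
`z`", then performs the fixed-`z` reduction for `𝒜_z = D(z, ·)`. [cite: BrakerskiEtAl2013, Lemma 4.8 (proof)] -/
def extLWEMultiReductionZ (χ : PMF (Fin n → ℤ)) (t : ℕ) [NeZero t]
    (D : (Fin n → ℤ) × (Matrix (Fin k) (Fin n) R × (Fin t → (Fin n → R) × ℤ)) → PMF Bool) :
    (Fin n → ℤ) × (Matrix (Fin k) (Fin n) R × (Fin 1 → (Fin n → R) × ℤ)) → PMF Bool :=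
  fun p => extLWEMultiReduction χ t p.1 (fun τ => D (p.1, τ)) p.2

omit [CommRing R] [Fintype R] in
/-- **Acceptance probability of a `z`-choosing game is the `ζ`-average of the fixed-`z` ones.** [folklore] -/
theorem toReal_acceptProb_choice {α β : Type} (ζ : PMF α) (f : α → PMF β) (D : α × β → PMF Bool) :
    (acceptProb D (ζ.bind fun z => (f z).map (Prod.mk z))).toReal =
      ∑' z, (ζ z).toReal * (acceptProb (fun b => D (z, b)) (f z)).toReal := by
  unfold acceptProb
  rw [PMF.bind_bind, PMF.bind_apply, ENNReal.tsum_toReal_eq fun z => ENNReal.mul_ne_top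
    (PMF.apply_ne_top ζ z) (PMF.apply_ne_top _ _)]
  refine tsum_congr fun z => ?_
  rw [ENNReal.toReal_mul, PMF.bind_map]
  rfl

omit [CommRing R] [Fintype R] in
/-- The averaged terms are summable (bounded by `ζ z`). [folklore] -/
theorem summable_toReal_mul_acceptProb_sub {α β γ : Type} (ζ : PMF α) (D : α → β → PMF Bool)
    (E : α → γ → PMF Bool) (P : α → PMF β) (Q : α → PMF γ) :
    Summable fun z => (ζ z).toReal * ((acceptProb (D z) (P z)).toReal - (acceptProb (E z) (Q z)).toReal) := by
  refine PMF.summable_toReal_mul_of_abs_le_one ζ fun z => ?_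
  have h1 : (acceptProb (D z) (P z)).toReal ≤ 1 := by
    simpa using ENNReal.toReal_mono ENNReal.one_ne_top (acceptProb_le_one (D z) (P z))
  have h2 : (acceptProb (E z) (Q z)).toReal ≤ 1 := by
    simpa using ENNReal.toReal_mono ENNReal.one_ne_top (acceptProb_le_one (E z) (Q z))
  have h3 : 0 ≤ (acceptProb (D z) (P z)).toReal := ENNReal.toReal_nonneg
  have h4 : 0 ≤ (acceptProb (E z) (Q z)).toReal := ENNReal.toReal_nonneg
  rw [abs_le]; constructor <;> linarith

omit [CommRing R] [Fintype R] in
/-- Each averaged acceptance term is summable. [folklore] -/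
theorem summable_toReal_mul_acceptProb {α β : Type} (ζ : PMF α) (D : α → β → PMF Bool) (P : α → PMF β) :
    Summable fun z => (ζ z).toReal * (acceptProb (D z) (P z)).toReal := by
  refine PMF.summable_toReal_mul_of_abs_le_one ζ fun z => ?_
  rw [abs_of_nonneg ENNReal.toReal_nonneg]
  simpa using ENNReal.toReal_mono ENNReal.one_ne_top (acceptProb_le_one (D z) (P z))

/-- **BLPRS 2013, Lemma 4.8 for the `z`-choosing game**: for every law `ζ` of the adversary's `z` and every
adversary `D` of `extLWE^t`, `t · Adv^{ζ}[ℬ] = Adv^{ζ}[D]` with `ℬ = extLWEMultiReductionZ χ t D` (average the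
fixed-`z` signed identity over `z ← ζ`, then take absolute values).
[cite: BrakerskiEtAl2013, Lemma 4.8] -/
theorem extLWEAdvantageZ_multiReduction (ζ : PMF (Fin n → ℤ)) (χ : PMF (Fin n → ℤ)) (t : ℕ) [NeZero t]
    (D : (Fin n → ℤ) × (Matrix (Fin k) (Fin n) R × (Fin t → (Fin n → R) × ℤ)) → PMF Bool) :
    (t : ℝ) * extLWEAdvantageZ ζ χ 1 (extLWEMultiReductionZ χ t D) = extLWEAdvantageZ ζ χ t D := by
  have ht : (0 : ℝ) < t := by exact_mod_cast Nat.pos_of_ne_zero (NeZero.ne t)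
  unfold extLWEAdvantageZ extLWERealZ extLWEIdealZ
  rw [toReal_acceptProb_choice, toReal_acceptProb_choice, toReal_acceptProb_choice, toReal_acceptProb_choice,
    ← Summable.tsum_sub (summable_toReal_mul_acceptProb ζ _ _) (summable_toReal_mul_acceptProb ζ _ _),
    ← Summable.tsum_sub (summable_toReal_mul_acceptProb ζ _ _) (summable_toReal_mul_acceptProb ζ _ _),
    ← abs_of_pos ht, ← abs_mul, ← tsum_mul_left]
  congr 1
  refine tsum_congr fun z => ?_
  rw [← mul_sub, ← mul_sub, mul_left_comm]
  congr 1
  exact toReal_acceptProb_extLWEMultiReduction_sub χ t z fun τ => D (z, τ)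

end LWE

end Literature.Computability.Cryptography

end
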